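import Mathlib
import Literature.Combinatorics.Additive.TripleProductProperty
import Literature.Barriers.MatrixMultiplication.QuasirandomBarrierProofs
import Literature.Combinatorics.Additive.NeumannTPPSubgroupIndex

/-!
# Two census pruning rules in the kernel: covering triples are isolated, and the quasirandom volume
# cap inside a certificate

Support file for route `MatrixMultiplication/GroupTheoreticSTPP`, crux `stmt-MatrixMultiplication-0597`
(`CNonabelianTPPFamilies`), cell `mm-stpp` (D-0046), answering the planner's statement requests S2 and S3
(HOME/CENSUS-PLAN.md §7; S2 was stated and proof-sketched by the planner seat mm-stpp-plan in
`HOME/mm-stpp-plan/CoveringIsolationSketch.lean`, farm rc 0 — landed here with tree hygiene and a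
decidable Finset form).

* **Covering triples are isolated** (CKSU Def. 5.1, clause (ii) with the index pattern `(i, j, j)`):
  for `i ≠ j` every quotient `a⁻¹c'` with `a ∈ Aᵢ`, `c' ∈ Cᵢ` avoids the set `Aⱼ⁻¹ Bⱼ Bⱼ⁻¹ Cⱼ`
  (`covering_isolation`); hence if `Aⱼ⁻¹ Bⱼ Bⱼ⁻¹ Cⱼ = G` for one triple `j` of an STPP family with all
  `Aᵢ, Cᵢ` non-empty, the family consists of that triple alone (`eq_of_cover`, `subsingleton_of_cover`,
  `card_le_one_of_cover`; Finset-product form `eq_of_cover_finset`, decidable on explicit groups).  Census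
  use (CENSUS-PLAN U7): a seed triple whose set `A⁻¹BB⁻¹C` is the whole host packs with nothing — e.g. the
  CKSU §2 triples in `Cyc_n³ ≀ C₂`.
* **Quasirandom cap inside a `d`-row certificate** (Blasiak–Cohn–Grochow–Pratt–Umans 2023, Thm. 3.2, tree
  `BCGPU2023_thm32_holds`: `V ≤ |G|^{3/2}/√n(G) + |G|` for a TPP triple in a non-abelian `G`): a
  single-triple certificate `d^{w−2}|G| < V^{w/3}` (`w ≥ 0`) forces
  `d^{w−2}|G| < (|G|^{3/2}/√n(G) + |G|)^{w/3}` (`quasirandom_certificate_bound`); together with the index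
  window of `TPPLaneObstruction` this is the planner's "U1 + U3" test for the family `ℤ_p ⋊ ℤ_t` (S3/S6).

WHAT THIS IS NOT: no statement about `ω`; pruning rules for the census (instrument).

## References
* H. Cohn, R. Kleinberg, B. Szegedy, C. Umans, FOCS 2005, Def. 5.1.
* J. Blasiak, H. Cohn, J. A. Grochow, K. Pratt, C. Umans, ITCS 2023, arXiv:2204.03826, Thm. 3.2.
-/

-- single-conjunct summit: the mandated namespace repeats `MatrixMultiplication`.
set_option linter.dupNamespace false

noncomputable section

namespace Summit.MatrixMultiplication.MatrixMultiplication.Theorems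

namespace STPPCensusRules

open Finset Literature.Combinatorics.Additive Literature.Barriers.MatrixMultiplication
  Literature.RepresentationTheory.FiniteGroups
open scoped Pointwise

/-! ### Covering triples are isolated (planner request S2 / rule U7) -/

section Covering

variable {G : Type} [Group G] {ι : Type} {A B C : ι → Finset G}

/-- **Pointwise form** of CKSU Def. 5.1 (ii) at the index pattern `(i, j, j)`: in an STPP family, for
`i ≠ j`, `a ∈ Aᵢ`, `c' ∈ Cᵢ`, `a' ∈ Aⱼ`, `b, b' ∈ Bⱼ`, `c ∈ Cⱼ` one has `a⁻¹ c' ≠ a'⁻¹ b b'⁻¹ c`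
(otherwise `a a'⁻¹ b b'⁻¹ c c'⁻¹ = 1` would force `i = j`). (Statement and proof: planner seat mm-stpp-plan.)
[cite: CohnKleinbergSzegedyUmans2005, Def. 5.1] -/
theorem covering_isolation (h : SimultaneousTPP A B C) {i j : ι} (hij : i ≠ j)
    {a : G} (ha : a ∈ A i) {c' : G} (hc' : c' ∈ C i) {a' : G} (ha' : a' ∈ A j)
    {b : G} (hb : b ∈ B j) {b' : G} (hb' : b' ∈ B j) {c : G} (hc : c ∈ C j) :
    a⁻¹ * c' ≠ a'⁻¹ * b * b'⁻¹ * c := by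
  intro he
  apply hij
  have key : a * a'⁻¹ * b * b'⁻¹ * c * c'⁻¹ = 1 := by
    have h1 : a * (a'⁻¹ * b * b'⁻¹ * c) * c'⁻¹ = 1 := by
      rw [← he]; group
    simpa [mul_assoc] using h1
  exact (h.2 i j j a ha a' ha' b hb b' hb' c hc c' hc' key).1

/-- **Covering triples are isolated.**  If for one index `j` of an STPP family the products
`a'⁻¹ b b'⁻¹ c` (`a' ∈ Aⱼ`, `b, b' ∈ Bⱼ`, `c ∈ Cⱼ`) exhaust `G`, and all `Aᵢ`, `Cᵢ` are non-empty, then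
every index equals `j`. [cite: CohnKleinbergSzegedyUmans2005, Def. 5.1] -/
theorem eq_of_cover (h : SimultaneousTPP A B C) (j : ι)
    (hcov : ∀ g : G, ∃ a' ∈ A j, ∃ b ∈ B j, ∃ b' ∈ B j, ∃ c ∈ C j, a'⁻¹ * b * b'⁻¹ * c = g)
    (hA : ∀ i, (A i).Nonempty) (hC : ∀ i, (C i).Nonempty) (i : ι) : i = j := by
  by_contra hij
  obtain ⟨a, ha⟩ := hA i
  obtain ⟨c', hc'⟩ := hC i
  obtain ⟨a', ha', b, hb, b', hb', c, hc, hg⟩ := hcov (a⁻¹ * c')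
  exact covering_isolation h hij ha hc' ha' hb hb' hc hg.symm

/-- Hence an STPP family containing a covering triple is indexed by a subsingleton.
[cite: CohnKleinbergSzegedyUmans2005, Def. 5.1] -/
theorem subsingleton_of_cover (h : SimultaneousTPP A B C) (j : ι)
    (hcov : ∀ g : G, ∃ a' ∈ A j, ∃ b ∈ B j, ∃ b' ∈ B j, ∃ c ∈ C j, a'⁻¹ * b * b'⁻¹ * c = g)
    (hA : ∀ i, (A i).Nonempty) (hC : ∀ i, (C i).Nonempty) : Subsingleton ι :=
  ⟨fun i i' => (eq_of_cover h j hcov hA hC i).trans (eq_of_cover h j hcov hA hC i').symm⟩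

/-- … and, for a finite index type, has at most one triple: `|ι| ≤ 1`.
[cite: CohnKleinbergSzegedyUmans2005, Def. 5.1] -/
theorem card_le_one_of_cover [Fintype ι] (h : SimultaneousTPP A B C) (j : ι)
    (hcov : ∀ g : G, ∃ a' ∈ A j, ∃ b ∈ B j, ∃ b' ∈ B j, ∃ c ∈ C j, a'⁻¹ * b * b'⁻¹ * c = g)
    (hA : ∀ i, (A i).Nonempty) (hC : ∀ i, (C i).Nonempty) : Fintype.card ι ≤ 1 := by
  haveI := subsingleton_of_cover h j hcov hA hC
  exact Fintype.card_le_one_iff_subsingleton.mpr ‹_›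

/-- **Finset form of the covering hypothesis** (decidable on explicit groups): if the pointwise product
`(A j)⁻¹ * B j * (B j)⁻¹ * C j` is `univ`, every index of the STPP family equals `j`.
[cite: CohnKleinbergSzegedyUmans2005, Def. 5.1] -/
theorem eq_of_cover_finset [Fintype G] [DecidableEq G] (h : SimultaneousTPP A B C) (j : ι)
    (hcov : (A j)⁻¹ * B j * (B j)⁻¹ * C j = Finset.univ)
    (hA : ∀ i, (A i).Nonempty) (hC : ∀ i, (C i).Nonempty) (i : ι) : i = j := by
  refine eq_of_cover h j (fun g => ?_) hA hC i
  have hg : g ∈ (A j)⁻¹ * B j * (B j)⁻¹ * C j := by rw [hcov]; exact Finset.mem_univ g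
  obtain ⟨x, hx, c, hc, rfl⟩ := Finset.mem_mul.1 hg
  obtain ⟨y, hy, z, hz, rfl⟩ := Finset.mem_mul.1 hx
  obtain ⟨u, hu, b, hb, rfl⟩ := Finset.mem_mul.1 hy
  rw [Finset.mem_inv'] at hu hz
  refine ⟨u⁻¹, hu, b, hb, z⁻¹, hz, c, hc, ?_⟩
  simp only [inv_inv]

end Covering

/-! ### The quasirandom cap inside a single-triple certificate (planner request S3 / rule U3) -/

section Quasirandom

variable {G : Type} [Group G] [Fintype G]

/-- **Quasirandom cap inside a certificate.**  If `G` is non-abelian, `S, T, U` satisfy the triple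
product property with `V = |S||T||U|`, and the single-triple certificate inequality `d^{w−2}|G| < V^{w/3}`
holds (`w ≥ 0`; the hypothesis of `STPPCriterion.omega_le_of_tpp_maxCharDegree`), then
`d^{w−2}|G| < (|G|^{3/2}/√n(G) + |G|)^{w/3}`, where `n(G) = secondCharDegree G` — by BCGPU 2023 Thm. 3.2
(`V ≤ |G|^{3/2}/√n(G) + |G|`, tree `BCGPU2023_thm32_holds`). [cite: BlasiakCohnGrochowPrattUmans2023, Thm. 3.2] -/
theorem quasirandom_certificate_bound (hna : ∃ a b : G, a * b ≠ b * a) {S T U : Finset G}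
    (h : TripleProductProperty S T U) {d w : ℝ} (hw : 0 ≤ w)
    (hcert : d ^ (w - 2) * Fintype.card G < ((S.card * T.card * U.card : ℕ) : ℝ) ^ (w / 3)) :
    d ^ (w - 2) * Fintype.card G <
      ((Fintype.card G : ℝ) ^ (3 / 2 : ℝ) / Real.sqrt (secondCharDegree G) + Fintype.card G) ^ (w / 3) := by
  have hcap := BCGPU2023_thm32_holds G hna S T U h
  exact hcert.trans_le (Real.rpow_le_rpow (Nat.cast_nonneg _) hcap (by linarith))

/-- **U1 + U3 together** (the planner's test for `ℤ_p ⋊ ℤ_t`-type hosts): a single-triple certificate at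
`w ≥ 2` in a non-abelian `G` with an abelian subgroup `K` forces BOTH `d^{w−2}|G| < ([G:K]²|G|)^{w/3}`
(Neumann 2011, Cor. 4.2) and `d^{w−2}|G| < (|G|^{3/2}/√n(G) + |G|)^{w/3}` (BCGPU 2023, Thm. 3.2).
[cite: Neumann2011, Cor. 4.2] [cite: BlasiakCohnGrochowPrattUmans2023, Thm. 3.2] -/
theorem certificate_two_caps (hna : ∃ a b : G, a * b ≠ b * a) (K : Subgroup G) [IsMulCommutative K]
    {S T U : Finset G} (h : TripleProductProperty S T U) {d w : ℝ} (hw : 0 ≤ w)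
    (hcert : d ^ (w - 2) * Fintype.card G < ((S.card * T.card * U.card : ℕ) : ℝ) ^ (w / 3)) :
    d ^ (w - 2) * Fintype.card G < ((K.index : ℝ) ^ 2 * Fintype.card G) ^ (w / 3) ∧
    d ^ (w - 2) * Fintype.card G <
      ((Fintype.card G : ℝ) ^ (3 / 2 : ℝ) / Real.sqrt (secondCharDegree G) + Fintype.card G) ^ (w / 3) := by
  classical
  refine ⟨hcert.trans_le (Real.rpow_le_rpow (Nat.cast_nonneg _) ?_ (by linarith)),
    quasirandom_certificate_bound hna h hw hcert⟩
  exact_mod_cast Neumann2011_cor42' K h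

end Quasirandom

end STPPCensusRules

end Summit.MatrixMultiplication.MatrixMultiplication.Theorems

end
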